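import Summits.CriticalPhenomena.CardyFormulaZ2.Theorems.CardyIKTransportIKLinearTransportWallDominationPlanar
import Summits.CriticalPhenomena.CardyFormulaZ2.Theorems.CardyIKTransportIKLinearTransportWallDominationCylSubset
import Summits.CriticalPhenomena.CardyFormulaZ2.Theorems.CardyIKTransportIKLinearTransportWallDominationBoxPlanar
import Summits.CriticalPhenomena.CardyFormulaZ2.Theorems.CardyIKTransportIKLinearTransportWallDominationShift
import Summits.CriticalPhenomena.CardyFormulaZ2.Theorems.CardyIKTransportIKLinearTransportWallDominationObsRing

/-!
# `CardyIKTransport.IKLinearTransport` (stmt-CriticalPhenomena-5076), line `pinned-diagram-exchange`, lead c8 —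
# THIN RINGS AROUND WALL SEGMENTS IN THE PLANE FOR THE ISOTROPIC IZERGIN–KOREPIN MODEL (unconditional)

Support file (`--supports stmt-CriticalPhenomena-5076`, registered sub-goal `thinRing_planar_iso`).  With the wave-3 sub-goals LANDED
(`thinRingCylSubset_pos` — the cylinder side with the corrected hypothesis `1 ≤ M`, worker B11; `stub_thinRingQ_planar`, `stub_marginQ_planar`
— worker B12; `stub_thinRingObs_shift` — worker B13; `stub_thinRingObs_ring` — worker B14, from the lattice Jordan lemma `thetaEnclosureChain`),
the composition of `…WallDominationPlanar.lean` is re-run with them: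

**THEOREM (`thinRing_planar_iso`).**  There are `N, j` and `c > 0` such that for every `s ≥ N` and every `(a, b) ∈ ℤ²`, with `ν_univ`-probability
`≥ c` no white path of the isotropic Izergin–Korepin cell model (corner fugacity `√3/2`, fair saddle coins — NOT positively associated) meeting
the wall segment `{a} × [b, b+s)` reaches sup-distance `2M + 3s` from it, `M = (2j+1)(s+1)`: a black circuit around the segment inside a
neighbourhood of bounded aspect ratio.  This is the ring clause of `stub_ringAll` (`S = univ`) in the regime "thin box, thick neighbourhood" —
the first RING statement for this model, obtained WITHOUT FKG: two-wall domination across the column through the segment (the FKG substitute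
of this seat) transfers the site-`𝕋` thin ring, the band comparison moves it to the plane, hard-crossing decay confines it, and the lattice
Jordan lemma closes it.
-/

noncomputable section

namespace Summit.CriticalPhenomena.CardyFormulaZ2.Theorems.IKLinearTransport.PinnedDiagramExchange.WallDomination

open scoped BigOperators Classical
open MeasureTheory
open Summit.CriticalPhenomena.CardyFormulaZ2.Cruxes.IKMixedBoxCrossing.DefectClosureExploration
open Summit.CriticalPhenomena.CardyFormulaZ2.Theorems.IKLinearTransport.PinnedDiagramExchange (Obs monoPaths farFrom cellGraph tbCross νmix
  isProbabilityMeasure_nuMix)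
open Summit.CriticalPhenomena.CardyFormulaZ2.Theorems.IKLinearTransport.PinnedDiagramExchange.HardCrossingDecay (pureIK_hardCrossing_decay_tb)
open Summit.CriticalPhenomena.CardyFormulaZ2.Cruxes.IKMixedBoxCrossing.PairedMirrorExploration (pTB)

open PlanarStub in
/-- **THIN RINGS AROUND WALL SEGMENTS IN THE PLANE, ISOTROPIC MODEL, THICK NEIGHBOURHOOD** (registered sub-goal `thinRing_planar_iso`;
route and arithmetic as in `thinRing_planar_iso_of`). -/
theorem thinRing_planar_iso : ∃ (N j : ℕ) (c : ℝ), 0 < c ∧ ∀ (s : ℕ) (a b : ℤ), N ≤ s →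
    c ≤ (νmix Set.univ).real (RingSeg a b s (2 * ((2 * j + 1) * (s + 1)) + 3 * s)) := by
  have hQ : ThinRingQ_planar := stub_thinRingQ_planar
  have hMQ : MarginQ_planar := stub_marginQ_planar
  have hShift : ThinRingObs_shift := stub_thinRingObs_shift
  have hRing : ThinRingObs_ring := stub_thinRingObs_ring
  obtain ⟨c₀, hc₀, hmargin⟩ := thinRingChain_margin_all
  obtain ⟨N, hN⟩ := pureIK_hardCrossing_decay_tb (1 / 2) (by norm_num)
  obtain ⟨j, hj⟩ := exists_pow_lt_of_lt_one (show 0 < c₀ / 8 by positivity) (show (3 : ℝ) / 4 < 1 by norm_num)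
  refine ⟨N + 1, j, c₀ / 4, by positivity, fun s a b hs => ?_⟩
  have hs1 : 1 ≤ s := by omega
  haveI : IsProbabilityMeasure (νmix Set.univ) := isProbabilityMeasure_nuMix _
  -- the geometry
  set M : ℕ := (2 * j + 1) * (s + 1) with hM
  set L : ℕ := 2 * M + 7 * s + 1 with hLdef
  haveI : NeZero L := ⟨by omega⟩
  have hM1 : 1 ≤ M := by rw [hM]; exact Nat.one_le_iff_ne_zero.2 (Nat.mul_ne_zero (by omega) (by omega))
  have hLcut : L = (2 * M + 3 * s - 1) + 1 + (4 * s + 1) := by omega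
  have hd : 2 * (s + s) + 1 ≤ 4 * s + 1 := by omega
  set τ : Fin (s + s) → Bool := fun _ => true with hτ
  have hτS : ∀ i : Fin (s + s), τ i = true ↔ ((i : ℕ) : ℤ) ∈ (Set.univ : Set ℤ) := fun i => by simp [hτ]
  -- STEP 1: the ring event contains the thin-ring event anchored at `(a - s, b - M - s)`
  have hsub : ThinRingObs (a - s) (b - M - s) s M ⊆ RingSeg a b s (2 * M + 3 * s) := by
    have h := hRing (a - s) (b - M - s) s M hs1
    rwa [show (a : ℤ) - s + s = a by ring, show (b : ℤ) - M - s + M + s = b by ring] at h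
  have step1 : (νmix Set.univ).real (ThinRingObs (a - s) (b - M - s) s M) ≤
      (νmix Set.univ).real (RingSeg a b s (2 * M + 3 * s)) := measureReal_mono hsub
  -- STEP 2–3: translation invariance, then the planar free box probability `q`
  have step23 : (νmix Set.univ).real (ThinRingObs (a - s) (b - M - s) s M) = CylPlane.qProb τ (ThinRingQ s M) := by
    rw [hShift, ← hQ s M hs1, nuMix_boxReadQ_eq_qProb Set.univ τ hτS]
  -- STEP 4: `cyl(band part in ThinRingQ) ≤ 2 q`
  have step4 : cylProb (s + s) L τ ((CylPlane.bandQ L (2 * M + 3 * s - 1) : CylCfg (s + s) L →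
      CylPlane.Q (s + s) (2 * M + 3 * s - 1)) ⁻¹' ThinRingQ s M) ≤ 2 * CylPlane.qProb τ (ThinRingQ s M) :=
    CylPlane.cylProb_bandQ_le hLcut hd τ _
  -- STEP 5–6: `c₀ ≤ cyl(thin ring) ≤ cyl(band part in ThinRingQ) + cyl(exit)`
  have step56 : c₀ ≤ cylProb (s + s) L τ ((CylPlane.bandQ L (2 * M + 3 * s - 1) : CylCfg (s + s) L →
      CylPlane.Q (s + s) (2 * M + 3 * s - 1)) ⁻¹' ThinRingQ s M) + cylProb (s + s) L τ (ExitCyl s M L) :=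
    (hmargin s M hs1 L rfl τ).trans ((CylPlane.cylProb_mono' τ (thinRingCylSubset_pos s M L hs1 hM1 rfl)).trans
      (CylPlane.cylProb_union_le τ _ _))
  -- STEP 7: each margin crossing costs at most `2 · ½ (3/4)^j`
  have step7 : ∀ i : Fin 4, cylProb (s + s) L τ ((CylPlane.bandQ L (2 * M + 3 * s - 1) : CylCfg (s + s) L →
      CylPlane.Q (s + s) (2 * M + 3 * s - 1)) ⁻¹' MarginQ s M i) ≤ 2 * (1 / 2 * ((1 + 1 / 2) / 2) ^ j) := by
    intro i
    refine (CylPlane.cylProb_bandQ_le hLcut hd τ _).trans (mul_le_mul_of_nonneg_left ?_ zero_le_two)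
    rw [← nuMix_boxReadQ_eq_qProb Set.univ τ hτS, hMQ s M hs1 i, nuMix_real_tbCross]
    have h := hN (s + 1) j (marginCorner s M i).1 (marginCorner s M i).2 (by omega)
    rwa [show (2 * j + 1) * (s + 1) = M from rfl] at h
  have hexit : cylProb (s + s) L τ (ExitCyl s M L) ≤ 4 * ((3 : ℝ) / 4) ^ j := by
    refine (cylProb_exit_le τ).trans ?_
    calc ∑ i : Fin 4, cylProb (s + s) L τ ((CylPlane.bandQ L (2 * M + 3 * s - 1) : CylCfg (s + s) L →
          CylPlane.Q (s + s) (2 * M + 3 * s - 1)) ⁻¹' MarginQ s M i)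
        ≤ ∑ _i : Fin 4, 2 * (1 / 2 * ((1 + 1 / 2) / 2) ^ j) := Finset.sum_le_sum fun i _ => step7 i
      _ = 4 * ((3 : ℝ) / 4) ^ j := by
          rw [Finset.sum_const, Finset.card_univ, Fintype.card_fin, nsmul_eq_mul]
          norm_num
          ring
  -- ARITHMETIC
  have hj' : 4 * ((3 : ℝ) / 4) ^ j ≤ c₀ / 2 := by linarith
  have hq : c₀ / 4 ≤ CylPlane.qProb τ (ThinRingQ s M) := by linarith
  calc c₀ / 4 ≤ CylPlane.qProb τ (ThinRingQ s M) := hq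
    _ = (νmix Set.univ).real (ThinRingObs (a - s) (b - M - s) s M) := step23.symm
    _ ≤ (νmix Set.univ).real (RingSeg a b s (2 * M + 3 * s)) := step1

end Summit.CriticalPhenomena.CardyFormulaZ2.Theorems.IKLinearTransport.PinnedDiagramExchange.WallDomination

end
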